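import Mathlib.MeasureTheory.Function.ConvergenceInMeasure
import Literature.Probability.LatticeModels.LupuCouplingFiniteVolume
import HarnessLib

/-!
# Lupu's coupling: the two-point bound `E[|φ_x φ_y| · P_φ(x ↔ y)] ≤ G(x - y)`

Topic `Literature/Probability/LatticeModels`. Brick 7 of the proof of
`Literature.Probability.LatticeModels.Lupu2016_cableSignClustersBounded` (Lupu 2016, Prop. 5.5).
We pass to infinite volume in the finite-volume identity of `LupuCouplingFiniteVolume.lean`
(`E[|ψ^n_x ψ^n_y| · P_{ψ^n}(x ↔ y in Λ_m)] ≤ G_{Λ_n}(x,y)`, `ψ^n = ψ^{Λ_n}` the finite-volume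
field of the box `Λ_n`) exactly as Lupu does at the end of the proof of his Prop. 4.2
("`ψ^{V_{n-1}}` converges in law to `ψ`"): along a subsequence `ψ^{n_k} → φ` a.e. at the finitely
many sites that matter (from the `L²` convergence `tendsto_integral_sub_dirichletField_sq`), the
local probability `P_·(x ↔ y in Λ_m)` is continuous in the field, and Fatou's lemma gives

* `integral_abs_mul_mul_prodBernoulli_connWithin_box_le` —
  **`E[|φ_x φ_y| · P_φ(x ↔ y in Λ_m)] ≤ G(x - y)`** (`G = latticeGreen / 2`) for every box `Λ_m`.

This is the (inequality form of the) two-point identity `E[φ_x φ_y 1_{x↔y}] = G(x,y)` behind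
Lupu's Prop. 5.2; the equality would need the sign-independence of INFINITE clusters (Lupu's
Thm. 1 bis in infinite volume, via the loop-soup limit), which the proof of Prop. 5.5 given in
these files avoids. Also: `latticeGreen_zero_pos`.

References: T. Lupu, Ann. Probab. 44 (2016), proof of Prop. 4.2 and Prop. 5.2 [`Lupu2016`].
-/

noncomputable section

namespace Literature.Probability.LatticeModels

open _root_.MeasureTheory _root_.ProbabilityTheory Finset Filter _root_.Topology
  Literature.Probability.Percolation
open scoped ENNReal NNReal

variable {d : ℕ}

/-! ### Sign of the Green function -/

variable (d) in
/-- **`latticeGreen 0 > 0`** (`d ≥ 3`): `Δ latticeGreen (0) = -2 < 0` is impossible at a zero of a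
nonnegative function. [folklore] -/
theorem latticeGreen_zero_pos (hd : 3 ≤ d) : 0 < latticeGreen (0 : Site d) := by
  by_contra h
  have h0 : latticeGreen (0 : Site d) = 0 := le_antisymm (not_lt.1 h) (latticeGreen_nonneg d hd 0)
  have hΔ := latticeLaplacianZd_latticeGreen_zero d hd
  rw [latticeLaplacianZd, h0, mul_zero, sub_zero] at hΔ
  have : (0 : ℝ) ≤ ∑ i : Fin d, (latticeGreen ((0 : Site d) + Pi.single i 1) +
      latticeGreen ((0 : Site d) - Pi.single i 1)) :=
    Finset.sum_nonneg fun i _ => add_nonneg (latticeGreen_nonneg d hd _) (latticeGreen_nonneg d hd _)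
  linarith

/-! ### Locality of the conditional connection probabilities -/

/-- The symmetric weight of `{a,b}` depends only on the field at `a` and `b`. [folklore] -/
theorem symWeight_mk_congr {φ₁ φ₂ : Site d → ℝ} {a b : Site d} (ha : φ₁ a = φ₂ a)
    (hb : φ₁ b = φ₂ b) : symWeight φ₁ s(a, b) = symWeight φ₂ s(a, b) := by
  simp only [symWeight, Sym2.map_mk, ha, hb]

/-- `P_φ(x ↔ y in Λ)` depends only on the field on `Λ`. [folklore] -/
theorem prodBernoulli_real_connWithin_congr {Λ : Finset (Site d)} {φ₁ φ₂ : Site d → ℝ}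
    (h : ∀ z ∈ Λ, φ₁ z = φ₂ z) (x y : Site d) :
    (prodBernoulli (symWeight φ₁)).real (connWithin Λ x y) =
      (prodBernoulli (symWeight φ₂)).real (connWithin Λ x y) := by
  refine prodBernoulli_real_eq_of_determinedBy _ _ (fun e he => ?_) (determinedBy_connWithin Λ x y)
    (determinedBy_connWithin Λ x y).measurableSet_of_finset
  induction e using Sym2.ind with
  | _ a b =>
    rw [Finset.mem_coe, mem_edgesIn_iff] at he
    exact symWeight_mk_congr (h a (he.2 a (Sym2.mem_mk_left a b)))
      (h b (he.2 b (Sym2.mem_mk_right a b)))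

namespace IsDiscreteGFF

variable {ν : Measure (Site d → ℝ)}

/-- The coordinate differences `φ_z - ψ^Λ_z` are square integrable. [folklore] -/
theorem memLp_coord_sub_dirichletField (hν : IsDiscreteGFF ν (coordProc d)) (Λ : Finset (Site d))
    (z : Site d) : MemLp (fun φ : Site d → ℝ => φ z - dirichletField Λ φ z) 2 ν :=
  (hν.memLp_coord z).sub ((hν.isGaussianProcess_dirichletField Λ).hasGaussianLaw_eval z).memLp_two

/-- **The two-point bound in a box** (`d ≥ 3`): for every box `Λ_m` and all `x, y`,
`E[|φ_x φ_y| · P_φ(x ↔ y in Λ_m)] ≤ G(x - y)`, `G = latticeGreen / 2`, where `P_φ` is the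
conditional bond law with Lupu's symmetric weights. Proof: the finite-volume inequality for
`ψ^{Λ_n}`, `n ≥ m` (`integral_abs_mul_mul_prodBernoulli_connWithin_le`), an a.e.-convergent
subsequence `ψ^{Λ_{n_k}} → φ` at the sites of `Λ_m ∪ {x,y}` (`L²` convergence + convergence in
measure), continuity of the local probability in the field, Fatou's lemma, and
`G_{Λ_n}(x,y) → G(x-y)`. [cite: Lupu2016, proof of Prop. 4.2 and Prop. 5.2] -/
theorem integral_abs_mul_mul_prodBernoulli_connWithin_box_le (hν : IsDiscreteGFF ν (coordProc d))
    (hd : 3 ≤ d) (m : ℕ) (x y : Site d) :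
    ∫ φ, |φ x * φ y| * (prodBernoulli (symWeight φ)).real (connWithin (box d m) x y) ∂ν ≤
      latticeGreen (x - y) / 2 := by
  classical
  have hprob : IsProbabilityMeasure ν := hν.1.isProbabilityMeasure
  set F : Finset (Site d) := insert x (insert y (box d m)) with hF
  have hxF : x ∈ F := Finset.mem_insert_self _ _
  have hyF : y ∈ F := Finset.mem_insert_of_mem (Finset.mem_insert_self _ _)
  have hbF : box d m ⊆ F := fun z hz => Finset.mem_insert_of_mem (Finset.mem_insert_of_mem hz)
  set ψ : ℕ → (Site d → ℝ) → Site d → ℝ := fun n φ => dirichletField (box d n) φ with hψ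
  -- Step 1: `S_n = ∑_{z ∈ F} (φ_z - ψ^n_z)² → 0` in `L¹`
  set S : ℕ → (Site d → ℝ) → ℝ := fun n φ => ∑ z ∈ F, (φ z - ψ n φ z) ^ 2 with hS
  have hSnn : ∀ n φ, 0 ≤ S n φ := fun n φ => Finset.sum_nonneg fun z _ => sq_nonneg _
  have hSint : ∀ n, Integrable (S n) ν := fun n =>
    integrable_finsetSum _ fun z _ => (hν.memLp_coord_sub_dirichletField (box d n) z).integrable_sq
  have hSlim : Tendsto (fun n => ∫ φ, S n φ ∂ν) atTop (𝓝 0) := by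
    have heq : ∀ n, ∫ φ, S n φ ∂ν = ∑ z ∈ F, ∫ φ, (φ z - ψ n φ z) ^ 2 ∂ν := fun n =>
      integral_finsetSum _ fun z _ => (hν.memLp_coord_sub_dirichletField (box d n) z).integrable_sq
    simp_rw [heq]
    rw [show (0 : ℝ) = ∑ z ∈ F, (0 : ℝ) by simp]
    exact tendsto_finsetSum _ fun z _ => hν.tendsto_integral_sub_dirichletField_sq hd z
  -- Step 2: convergence in measure and an a.e.-convergent subsequence
  have hmeas : TendstoInMeasure ν S atTop (fun _ => (0 : ℝ)) := by
    refine tendstoInMeasure_of_tendsto_eLpNorm one_ne_zero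
      (fun n => (hSint n).aestronglyMeasurable) aestronglyMeasurable_const ?_
    have heq : ∀ n, eLpNorm (S n - fun _ => (0 : ℝ)) 1 ν = ENNReal.ofReal (∫ φ, S n φ ∂ν) := by
      intro n
      have h0 : (S n - fun _ => (0 : ℝ)) = S n := by funext φ; simp
      rw [h0, eLpNorm_one_eq_lintegral_enorm, ← ofReal_integral_norm_eq_lintegral_enorm (hSint n)]
      congr 1
      exact integral_congr_ae (ae_of_all _ fun φ => Real.norm_of_nonneg (hSnn n φ))
    simp_rw [heq]
    rw [← ENNReal.ofReal_zero]
    exact ENNReal.tendsto_ofReal hSlim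
  obtain ⟨ns, hns, hae⟩ := hmeas.exists_seq_tendsto_ae
  -- Step 3: the modified fields `χ_i → φ` a.e. in the product topology
  set χ : ℕ → (Site d → ℝ) → Site d → ℝ := fun i φ z => if z ∈ F then ψ (ns i) φ z else φ z
    with hχ
  have hχlim : ∀ᵐ φ ∂ν, Tendsto (fun i => χ i φ) atTop (𝓝 φ) := by
    filter_upwards [hae] with φ hφ
    rw [tendsto_pi_nhds]
    intro z
    by_cases hz : z ∈ F
    · simp only [hχ, hz, if_true]
      have h2 : Tendsto (fun i => (φ z - ψ (ns i) φ z) ^ 2) atTop (𝓝 0) :=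
        squeeze_zero (fun i => sq_nonneg _)
          (fun i => Finset.single_le_sum (f := fun w => (φ w - ψ (ns i) φ w) ^ 2)
            (fun w _ => sq_nonneg _) hz) hφ
      have h3 : Tendsto (fun i => |φ z - ψ (ns i) φ z|) atTop (𝓝 0) := by
        have := (Real.continuous_sqrt.tendsto 0).comp h2
        simpa [Function.comp_def, Real.sqrt_sq_eq_abs] using this
      have h4 : Tendsto (fun i => φ z - ψ (ns i) φ z) atTop (𝓝 0) :=
        (tendsto_zero_iff_abs_tendsto_zero _).2 h3
      have h5 := tendsto_const_nhds (x := φ z) |>.sub h4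
      simpa using h5
    · simp only [hχ, hz, if_false]
      exact tendsto_const_nhds
  -- Step 4: the continuous functional `H` and `f_i = H ∘ χ_i`
  set H : (Site d → ℝ) → ℝ := fun φ' =>
    |φ' x * φ' y| * (prodBernoulli (symWeight φ')).real (connWithin (box d m) x y) with hH
  have hHc : Continuous H := ((continuous_apply x).mul (continuous_apply y)).abs.mul
    (continuous_prodBernoulli_symWeight_real (determinedBy_connWithin (box d m) x y))
  have hHnn : ∀ φ', 0 ≤ H φ' := fun φ' => mul_nonneg (abs_nonneg _) measureReal_nonneg
  have hfeq : ∀ i φ, |ψ (ns i) φ x * ψ (ns i) φ y| *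
      (prodBernoulli (symWeight (ψ (ns i) φ))).real (connWithin (box d m) x y) = H (χ i φ) := by
    intro i φ
    simp only [hH, hχ, hxF, hyF, if_true]
    congr 1
    exact prodBernoulli_real_connWithin_congr (fun z hz => by simp [hbF hz]) x y
  -- Step 5: Fatou along the subsequence
  have hGlim : Tendsto (fun i => ENNReal.ofReal (dirichletGreen (box d (ns i)) x y)) atTop
      (𝓝 (ENNReal.ofReal (latticeGreen (x - y) / 2))) :=
    (ENNReal.continuous_ofReal.tendsto _).comp
      ((tendsto_dirichletGreen_box d hd x y).comp hns.tendsto_atTop)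
  have hev : ∀ᶠ i in atTop, ∫⁻ φ, ENNReal.ofReal (H (χ i φ)) ∂ν ≤
      ENNReal.ofReal (dirichletGreen (box d (ns i)) x y) := by
    have h1 : ∀ᶠ i in atTop, x ∈ box d (ns i) :=
      hns.tendsto_atTop.eventually (eventually_mem_box x)
    have h2 : ∀ᶠ i in atTop, m ≤ ns i := hns.tendsto_atTop.eventually (eventually_ge_atTop m)
    filter_upwards [h1, h2] with i hi1 hi2
    have hfi : Integrable (fun φ => H (χ i φ)) ν := by
      simp_rw [← hfeq]
      have hint : Integrable (fun φ : Site d → ℝ => ψ (ns i) φ x * ψ (ns i) φ y) ν :=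
        ((hν.isGaussianProcess_dirichletField _).hasGaussianLaw_eval x).memLp_two.integrable_mul
          ((hν.isGaussianProcess_dirichletField _).hasGaussianLaw_eval y).memLp_two
      simp_rw [mul_comm _ ((prodBernoulli _).real _)]
      refine hint.abs.bdd_mul (c := 1) ?_ (Eventually.of_forall fun φ => ?_)
      · exact ((continuous_prodBernoulli_symWeight_real (determinedBy_connWithin (box d m) x y)
          ).measurable.comp (measurable_pi_lambda _ (measurable_dirichletField _))).aestronglyMeasurable
      · rw [Real.norm_eq_abs, abs_of_nonneg measureReal_nonneg]; exact measureReal_le_one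
    rw [← ofReal_integral_eq_lintegral_ofReal hfi (ae_of_all _ fun φ => hHnn _)]
    refine ENNReal.ofReal_le_ofReal ?_
    simp_rw [← hfeq]
    exact hν.integral_abs_mul_mul_prodBernoulli_connWithin_le hd (box_mono d hi2) hi1 y
  have key : ∫⁻ φ, ENNReal.ofReal (H φ) ∂ν ≤ ENNReal.ofReal (latticeGreen (x - y) / 2) := by
    have hlim : ∀ᵐ φ ∂ν, Tendsto (fun i => ENNReal.ofReal (H (χ i φ))) atTop
        (𝓝 (ENNReal.ofReal (H φ))) :=
      hχlim.mono fun φ hφ => (ENNReal.continuous_ofReal.tendsto _).comp ((hHc.tendsto φ).comp hφ)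
    have hmi : ∀ i, Measurable fun φ => ENNReal.ofReal (H (χ i φ)) := fun i => by
      refine ENNReal.measurable_ofReal.comp (hHc.measurable.comp (measurable_pi_lambda _ fun z => ?_))
      by_cases hz : z ∈ F
      · simp only [hχ, hz, if_true]; exact measurable_dirichletField _ z
      · simp only [hχ, hz, if_false]; exact measurable_pi_apply z
    calc ∫⁻ φ, ENNReal.ofReal (H φ) ∂ν
        = ∫⁻ φ, liminf (fun i => ENNReal.ofReal (H (χ i φ))) atTop ∂ν :=
          lintegral_congr_ae (hlim.mono fun φ hφ => hφ.liminf_eq.symm)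
      _ ≤ liminf (fun i => ∫⁻ φ, ENNReal.ofReal (H (χ i φ)) ∂ν) atTop := lintegral_liminf_le hmi
      _ ≤ liminf (fun i => ENNReal.ofReal (dirichletGreen (box d (ns i)) x y)) atTop :=
          liminf_le_liminf hev
      _ = ENNReal.ofReal (latticeGreen (x - y) / 2) := hGlim.liminf_eq
  -- Step 6: back to the Bochner integral
  have hHint : Integrable H ν := by
    have hint : Integrable (fun φ : Site d → ℝ => φ x * φ y) ν := hν.integrable_coord_mul x y
    simp_rw [hH, mul_comm _ ((prodBernoulli _).real _)]
    refine hint.abs.bdd_mul (c := 1) ?_ (Eventually.of_forall fun φ => ?_)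
    · exact (continuous_prodBernoulli_symWeight_real
        (determinedBy_connWithin (box d m) x y)).measurable.aestronglyMeasurable
    · rw [Real.norm_eq_abs, abs_of_nonneg measureReal_nonneg]; exact measureReal_le_one
  change ∫ φ, H φ ∂ν ≤ _
  rw [integral_eq_lintegral_of_nonneg_ae (ae_of_all _ fun φ => hHnn φ) hHint.aestronglyMeasurable]
  exact ENNReal.toReal_le_of_le_ofReal (div_nonneg (latticeGreen_nonneg d hd _) zero_le_two) key

end IsDiscreteGFF

end Literature.Probability.LatticeModels
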